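import Literature.RingTheory.Flat.TorBaseChange
import Literature.RingTheory.Flat.LocalCriterion
import Literature.RingTheory.Flat.NoetherianApproximation
import Mathlib.RingTheory.Flat.EquationalCriterion
import Mathlib.RingTheory.Localization.BaseChange
import Mathlib.RingTheory.Localization.AtPrime.Basic
import Mathlib.Algebra.Module.LocalizedModule.IsLocalization
import Mathlib.RingTheory.Localization.Submodule
import Mathlib.RingTheory.Localization.LocalizationLocalization
import Mathlib.RingTheory.Flat.Localization
import Mathlib.RingTheory.Flat.Stability
import HarnessLib

/-!
# Flatness spreads out over the absolute Noetherian approximation, at a prime (Stacks 00R6)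

Let `A` be a ring, `f₁, …, f_m ∈ A[x₁, …, x_n]`, `A[x]/(f) = colim_T P_T` the absolute Noetherian
approximation of `Literature.RingTheory.Flat.NoetherianApproximation` (`T` ranging over the
finitely generated subrings of `A` containing the coefficients of the `fᵢ`,
`P_T = T[x]/(f)`), and let `𝔮` be a prime of `A[x]/(f)`.  Write `𝔭_T = 𝔮 ∩ T`, `R_T = T_{𝔭_T}`,
`M_T = (P_T)_{𝔭_T}` and `𝔮_T = 𝔮 ∩ P_T`.

## Main results

* `Idx.isBaseChange_psi`: `M_{T′} = R_{T′} ⊗_{R_T} M_T` for `T ⊆ T′` (Stacks 00R0 (4)).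
* `Idx.exists_normalForm`: the normal form at level `∞` of a relation `Σ πₖ mₖ = 0` in `M_T`
  (`πₖ` generators of `𝔭_T`), obtained from the equational criterion of flatness for the flat
  `A_𝔭`-module `(A[x]/(f))_𝔭`.
* `Idx.theta_eq_zero_of_normalForm`: at a level `T′` containing the coefficients of the normal
  form, the relation dies in `M_{T′} ⊗_{R_{T′}} 𝔪_{R_T}R_{T′}`.
* `flat_of_isBaseChange_of_injective`: the abstract form of Stacks 00MO + 00MK used at level
  `T′`.
* `Idx.exists_flat_atPrime` (**Stacks 00R6 at a prime**): if `A[x]/(f)` is flat over `A`, then for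
  every `T` there is a finite `W ⊆ A` such that `(P_{T′})_{𝔮_{T′}}` is flat over `T′` for every
  `T′ ⊇ T ∪ W`.

Also: `lTensor_injective_of_isBaseChange_of_isMaximal` (the `IsBaseChange` form of
`TorBaseChange`'s criterion), `injective_lTensor_of_flat`, `injective_lTensor_of_isBaseChange`.

## References

* [The Stacks Project, Tags 00R6, 00R0, 00MO, 00MK][StacksProject]
-/

universe u u' v w

open TensorProduct

noncomputable section

namespace Literature.RingTheory.Flat

/-! ### `TorBaseChange` in `IsBaseChange` form -/

section IsBaseChangeForm

variable {R : Type u} [CommRing R] {R' : Type u'} [CommRing R'] [Algebra R R'] (I : Ideal R)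
  {M : Type v} [AddCommGroup M] [Module R M]
  {M₂ : Type w} [AddCommGroup M₂] [Module R M₂] [Module R' M₂] [IsScalarTower R R' M₂]
  (φ : M →ₗ[R] M₂) (hφ : IsBaseChange R' φ)

/-- The comparison map `θ′ : M ⊗_R I → M₂ ⊗_{R′} IR′`, `m ⊗ i ↦ φ m ⊗ i`, for a base change
`φ : M → M₂` along `R → R′`. [folklore] -/
noncomputable def baseChangeTor' : M ⊗[R] ↥I →ₗ[R] M₂ ⊗[R'] ↥(I.map (algebraMap R R')) :=
  ((LinearMap.rTensor ↥(I.map (algebraMap R R')) hφ.equiv.toLinearMap).restrictScalars R) ∘ₗ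
    ((baseChangeTor I M).restrictScalars R) ∘ₗ (TensorProduct.mk R R' (M ⊗[R] ↥I) 1)

/-- `θ′ (m ⊗ i) = φ m ⊗ i`. [folklore] -/
@[simp] theorem baseChangeTor'_tmul (m : M) (i : ↥I) :
    baseChangeTor' I φ hφ (m ⊗ₜ[R] i) = φ m ⊗ₜ[R'] mulMapIdeal I ((1 : R') ⊗ₜ[R] i) := by
  simp [baseChangeTor', IsBaseChange.equiv_tmul]

/-- `θ′ x = (e ⊗ 1) (π (1 ⊗ x))` with `e : R′ ⊗ M ≃ M₂`. [folklore] -/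
theorem baseChangeTor'_apply (x : M ⊗[R] ↥I) :
    baseChangeTor' I φ hφ x =
      LinearMap.rTensor _ hφ.equiv.toLinearMap (baseChangeTor I M ((1 : R') ⊗ₜ[R] x)) := rfl

/-- **`IsBaseChange` form of `lTensor_injective_baseChange_of_isMaximal`**: for a maximal ideal
`I ⊆ R`, a base change `φ : M → M₂` along `R → R′`, if `θ′` kills `Ker(M ⊗_R I → M)` then
`M₂ ⊗_{R′} IR′ → M₂ ⊗_{R′} R′` is injective (`Tor₁^{R′}(R′/IR′, M₂) = 0`).
[cite: StacksProject, Tag 00MO (proof)] -/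
theorem lTensor_injective_of_isBaseChange_of_isMaximal [I.IsMaximal]
    (hθ : ∀ x : M ⊗[R] ↥I, smulMap I M x = 0 → baseChangeTor' I φ hφ x = 0) :
    Function.Injective (LinearMap.lTensor M₂ (I.map (algebraMap R R')).subtype) := by
  set I' := I.map (algebraMap R R')
  let e : R' ⊗[R] M ≃ₗ[R'] M₂ := hφ.equiv
  have hinj : ∀ (Q : Type u') [AddCommGroup Q] [Module R' Q],
      Function.Injective (LinearMap.rTensor Q e.toLinearMap) := fun Q _ _ => by
    rw [← LinearEquiv.coe_rTensor]
    exact (e.rTensor Q).injective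
  -- the tensor-product form
  have h1 : Function.Injective (LinearMap.lTensor (R' ⊗[R] M) I'.subtype) := by
    refine lTensor_injective_baseChange_of_isMaximal I M fun x hx => ?_
    have h := hθ x hx
    rw [baseChangeTor'_apply] at h
    exact hinj _ (by rw [map_zero]; exact h)
  -- transport along `e`
  intro y₁ y₂ hy
  obtain ⟨z₁, rfl⟩ := (LinearEquiv.rTensor ↥I' e).surjective y₁
  obtain ⟨z₂, rfl⟩ := (LinearEquiv.rTensor ↥I' e).surjective y₂
  have key : ∀ z, LinearMap.lTensor M₂ I'.subtype (LinearEquiv.rTensor ↥I' e z) =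
      LinearMap.rTensor R' e.toLinearMap (LinearMap.lTensor (R' ⊗[R] M) I'.subtype z) := by
    intro z
    change LinearMap.lTensor M₂ I'.subtype (LinearMap.rTensor ↥I' e.toLinearMap z) = _
    rw [← LinearMap.comp_apply, ← LinearMap.comp_apply,
      LinearMap.lTensor_comp_rTensor, LinearMap.rTensor_comp_lTensor]
  rw [key, key] at hy
  rw [h1 (hinj _ hy)]

end IsBaseChangeForm

/-! ### The local rings and localized algebras attached to a prime of `A[x]/(f)` -/

namespace Idx

variable {A : Type u} [CommRing A] {n m : ℕ} {f : Fin m → MvPolynomial (Fin n) A}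
  (𝔮 : Ideal (Pinf f))

omit 𝔮 in
/-- `P_T → A[x]/(f)` on elements of `T` (restated so that the `T`-algebra structure of `P_T` is
the one found by instance resolution here). [folklore] -/
theorem toPinf_algebraMap (lam : Idx f) (t : lam.T) :
    lam.toPinf (algebraMap lam.T lam.P t) = algebraMap A (Pinf f) t :=
  lam.toPinf.commutes t

/-- `𝔭 = 𝔮 ∩ A`. [folklore] -/
def pA : Ideal A := 𝔮.comap (algebraMap A (Pinf f))

/-- `𝔭_T = 𝔮 ∩ T`. [folklore] -/
def pT (lam : Idx f) : Ideal lam.T := 𝔮.comap (algebraMap lam.T (Pinf f))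

/-- `𝔮_T = 𝔮 ∩ P_T`. [folklore] -/
def qT (lam : Idx f) : Ideal lam.P := 𝔮.comap (lam.toPinf : lam.P →+* Pinf f)

/-- `𝔭_T = 𝔭 ∩ T`. [folklore] -/
theorem pT_eq_comap_pA (lam : Idx f) : lam.pT 𝔮 = (pA 𝔮).comap (algebraMap lam.T A) := by
  rw [pA, Ideal.comap_comap, ← IsScalarTower.algebraMap_eq]
  rfl

/-- `𝔮_T ∩ T = 𝔭_T`. [folklore] -/
theorem comap_qT (lam : Idx f) : (lam.qT 𝔮).comap (algebraMap lam.T lam.P) = lam.pT 𝔮 := by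
  ext t
  simp only [qT, pT, Ideal.mem_comap, RingHom.coe_coe]
  exact Iff.of_eq (congrArg (· ∈ 𝔮) (lam.toPinf.commutes t))

variable [𝔮.IsPrime]

/-- `𝔭` is prime. [folklore] -/
instance pA_isPrime : (pA 𝔮).IsPrime := Ideal.IsPrime.comap _

/-- `𝔭_T` is prime. [folklore] -/
instance pT_isPrime (lam : Idx f) : (lam.pT 𝔮).IsPrime := Ideal.IsPrime.comap _

/-- `𝔮_T` is prime. [folklore] -/
instance qT_isPrime (lam : Idx f) : (lam.qT 𝔮).IsPrime := Ideal.IsPrime.comap _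

/-- `𝔭` lies over `𝔭_T`. [folklore] -/
instance pA_liesOver (lam : Idx f) : (pA 𝔮).LiesOver (lam.pT 𝔮) := ⟨lam.pT_eq_comap_pA 𝔮⟩

/-- **`R_T = T_{𝔭_T}`**, a Noetherian local ring. [folklore] -/
abbrev RT (lam : Idx f) : Type u := Localization.AtPrime (lam.pT 𝔮)

/-- `R_T` is Noetherian. [folklore] -/
instance RT_isNoetherianRing (lam : Idx f) : IsNoetherianRing (lam.RT 𝔮) :=
  IsLocalization.isNoetherianRing (lam.pT 𝔮).primeCompl _ lam.isNoetherianRing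

/-- The multiplicative subset of `P_T` generated by `T ∖ 𝔭_T`. [folklore] -/
abbrev ST (lam : Idx f) : Submonoid lam.P :=
  Algebra.algebraMapSubmonoid lam.P (lam.pT 𝔮).primeCompl

/-- **`M_T = (P_T)_{𝔭_T}`**, the localization of `P_T` at `T ∖ 𝔭_T`: a Noetherian `R_T`-algebra.
[folklore] -/
abbrev MT (lam : Idx f) : Type u := Localization (lam.ST 𝔮)

/-- `M_T` is Noetherian. [folklore] -/
instance MT_isNoetherianRing (lam : Idx f) : IsNoetherianRing (lam.MT 𝔮) :=
  IsLocalization.isNoetherianRing (lam.ST 𝔮) _ inferInstance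

/-- **`A_𝔭`**. [folklore] -/
abbrev Rinf : Type u := Localization.AtPrime (pA 𝔮)

/-- The multiplicative subset of `A[x]/(f)` generated by `A ∖ 𝔭`. [folklore] -/
abbrev Sinf : Submonoid (Pinf f) := Algebra.algebraMapSubmonoid (Pinf f) (pA 𝔮).primeCompl

/-- **`M_∞ = (A[x]/(f))_𝔭`**. [folklore] -/
abbrev Minf : Type u := Localization (Sinf 𝔮)

/-- `M_∞` is flat over `A_𝔭` when `A[x]/(f)` is flat over `A`. [folklore] -/
theorem flat_Minf [Module.Flat A (Pinf f)] : Module.Flat (Rinf 𝔮) (Minf 𝔮) := by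
  haveI : Module.Flat (Pinf f) (Minf 𝔮) := IsLocalization.flat (Minf 𝔮) (Sinf 𝔮)
  haveI : Module.Flat A (Minf 𝔮) := Module.Flat.trans A (Pinf f) (Minf 𝔮)
  exact (Module.flat_iff_of_isLocalization (Rinf 𝔮) (pA 𝔮).primeCompl (Minf 𝔮)).mpr ‹_›

/-! #### Maps to level `∞` -/

/-- `R_T → A_𝔭`. [folklore] -/
instance algebra_RT_Rinf (lam : Idx f) : Algebra (lam.RT 𝔮) (Rinf 𝔮) :=
  Localization.AtPrime.algebraOfLiesOver (lam.pT 𝔮) (pA 𝔮)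

/-- `R_T → A_𝔭` is the local ring map induced by `T → A`. [folklore] -/
theorem algebraMap_RT_Rinf (lam : Idx f) :
    algebraMap (lam.RT 𝔮) (Rinf 𝔮) =
      Localization.localRingHom (lam.pT 𝔮) (pA 𝔮) (algebraMap lam.T A)
        (lam.pT_eq_comap_pA 𝔮) := rfl

/-- `T → R_T → A_𝔭` is `T → A_𝔭`. [folklore] -/
instance isScalarTower_T_RT_Rinf (lam : Idx f) : IsScalarTower lam.T (lam.RT 𝔮) (Rinf 𝔮) :=
  IsScalarTower.of_algebraMap_eq fun t => by
    rw [algebraMap_RT_Rinf, Localization.localRingHom_to_map]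
    rfl

/-- `T ∖ 𝔭_T` maps into `A ∖ 𝔭`. [folklore] -/
theorem ST_le_comap_Sinf (lam : Idx f) :
    lam.ST 𝔮 ≤ (Sinf 𝔮).comap (lam.toPinf : lam.P →+* Pinf f) := by
  rintro _ ⟨t, ht, rfl⟩
  refine ⟨(t : A), ?_, ?_⟩
  · intro h
    exact ht (show t ∈ lam.pT 𝔮 by rw [pT_eq_comap_pA]; exact h)
  · exact (lam.toPinf.commutes t).symm

/-- `M_T → M_∞`, as an algebra structure. [folklore] -/
instance algebra_MT_Minf (lam : Idx f) : Algebra (lam.MT 𝔮) (Minf 𝔮) :=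
  (IsLocalization.map (Minf 𝔮) (lam.toPinf : lam.P →+* Pinf f) (lam.ST_le_comap_Sinf 𝔮)).toAlgebra

/-- `M_T → M_∞` is the localization map induced by `P_T → A[x]/(f)`. [folklore] -/
theorem algebraMap_MT_Minf (lam : Idx f) :
    algebraMap (lam.MT 𝔮) (Minf 𝔮) =
      IsLocalization.map (Minf 𝔮) (lam.toPinf : lam.P →+* Pinf f) (lam.ST_le_comap_Sinf 𝔮) := rfl

/-- `P_T → M_T → M_∞` is `P_T → A[x]/(f) → M_∞`. [folklore] -/
theorem algebraMap_MT_Minf_algebraMap (lam : Idx f) (x : lam.P) :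
    algebraMap (lam.MT 𝔮) (Minf 𝔮) (algebraMap lam.P (lam.MT 𝔮) x) =
      algebraMap (Pinf f) (Minf 𝔮) (lam.toPinf x) := by
  rw [algebraMap_MT_Minf, IsLocalization.map_eq]
  rfl

/-- `R_T → M_T → M_∞` is `R_T → A_𝔭 → M_∞`. [folklore] -/
theorem algebraMap_MT_Minf_comp (lam : Idx f) :
    (algebraMap (lam.MT 𝔮) (Minf 𝔮)).comp (algebraMap (lam.RT 𝔮) (lam.MT 𝔮)) =
      (algebraMap (Rinf 𝔮) (Minf 𝔮)).comp (algebraMap (lam.RT 𝔮) (Rinf 𝔮)) := by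
  apply IsLocalization.ringHom_ext (lam.pT 𝔮).primeCompl
  ext t
  rw [RingHom.comp_apply, RingHom.comp_apply, RingHom.comp_apply, RingHom.comp_apply]
  have h1 : algebraMap (lam.RT 𝔮) (lam.MT 𝔮) (algebraMap lam.T (lam.RT 𝔮) t) =
      algebraMap lam.P (lam.MT 𝔮) (algebraMap lam.T lam.P t) := by
    rw [← IsScalarTower.algebraMap_apply, IsScalarTower.algebraMap_apply lam.T lam.P (lam.MT 𝔮)]
  have h2 : algebraMap (lam.RT 𝔮) (Rinf 𝔮) (algebraMap lam.T (lam.RT 𝔮) t) =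
      algebraMap A (Rinf 𝔮) t := by
    rw [← IsScalarTower.algebraMap_apply lam.T (lam.RT 𝔮) (Rinf 𝔮),
      IsScalarTower.algebraMap_apply lam.T A (Rinf 𝔮)]
    rfl
  rw [h1, h2, algebraMap_MT_Minf_algebraMap, toPinf_algebraMap,
    ← IsScalarTower.algebraMap_apply A (Rinf 𝔮) (Minf 𝔮),
    IsScalarTower.algebraMap_apply A (Pinf f) (Minf 𝔮)]

/-! #### Transition structures for `T ≤ T′` -/

section LE

variable {lam mu : Idx f} [Algebra lam.T mu.T] [IsScalarTower lam.T mu.T A]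

omit [𝔮.IsPrime] in
/-- `T → T′ → A[x]/(f)` is `T → A[x]/(f)`. [folklore] -/
instance isScalarTower_T_T_Pinf : IsScalarTower lam.T mu.T (Pinf f) :=
  IsScalarTower.of_algebraMap_eq fun t => by
    change algebraMap A (Pinf f) (t : A) = algebraMap A (Pinf f) (algebraMap lam.T mu.T t : A)
    rw [coe_algebraMap]

omit [𝔮.IsPrime] in
/-- `𝔭_{T′} ∩ T = 𝔭_T`. [folklore] -/
theorem comap_pT : (mu.pT 𝔮).comap (algebraMap lam.T mu.T) = lam.pT 𝔮 := by
  rw [pT, pT, Ideal.comap_comap, ← IsScalarTower.algebraMap_eq]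

/-- `𝔭_{T′}` lies over `𝔭_T`. [folklore] -/
instance pT_liesOver : (mu.pT 𝔮).LiesOver (lam.pT 𝔮) := ⟨(comap_pT 𝔮).symm⟩

omit [𝔮.IsPrime] in
/-- `incl` on elements of `T` (restated for the instance path used here). [folklore] -/
theorem incl_algebraMap (t : lam.T) :
    (incl : lam.P →ₐ[lam.T] mu.P) (algebraMap lam.T lam.P t) = algebraMap lam.T mu.P t :=
  (incl : lam.P →ₐ[lam.T] mu.P).commutes t

omit [𝔮.IsPrime] in
/-- `P_T → P_{T′}` through `incl` (not an instance). [folklore] -/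
noncomputable abbrev algebraPP : Algebra lam.P mu.P :=
  (incl : lam.P →ₐ[lam.T] mu.P).toRingHom.toAlgebra

omit [𝔮.IsPrime] in
/-- `T → P_T → P_{T′}` is `T → P_{T′}`. [folklore] -/
theorem isScalarTower_T_P_P :
    letI := algebraPP (lam := lam) (mu := mu); IsScalarTower lam.T lam.P mu.P :=
  letI := algebraPP (lam := lam) (mu := mu)
  IsScalarTower.of_algebraMap_eq fun t => ((incl : lam.P →ₐ[lam.T] mu.P).commutes t).symm

/-- `R_T → R_{T′}` (not an instance: for `T = T′` it would compete with `Algebra.id`).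
[folklore] -/
noncomputable abbrev algebraRT : Algebra (lam.RT 𝔮) (mu.RT 𝔮) :=
  Localization.AtPrime.algebraOfLiesOver (lam.pT 𝔮) (mu.pT 𝔮)

/-- `T → R_T → R_{T′}` is `T → R_{T′}` for `algebraRT`. [folklore] -/
theorem isScalarTower_algebraRT :
    letI := algebraRT 𝔮 (lam := lam) (mu := mu)
    IsScalarTower lam.T (lam.RT 𝔮) (mu.RT 𝔮) :=
  letI := algebraRT 𝔮 (lam := lam) (mu := mu)
  IsScalarTower.of_algebraMap_eq fun t => by
    rw [IsScalarTower.algebraMap_apply lam.T mu.T (mu.RT 𝔮)]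
    exact (Localization.localRingHom_to_map (lam.pT 𝔮) (mu.pT 𝔮) (algebraMap lam.T mu.T)
      Ideal.LiesOver.over t).symm


/-- `T ∖ 𝔭_T` maps into `T′ ∖ 𝔭_{T′}`. [folklore] -/
theorem ST_le_comap_ST :
    lam.ST 𝔮 ≤ (mu.ST 𝔮).comap (incl : lam.P →ₐ[lam.T] mu.P).toRingHom := by
  rintro _ ⟨t, ht, rfl⟩
  refine ⟨algebraMap lam.T mu.T t, ?_, ?_⟩
  · intro h
    apply ht
    have : t ∈ (mu.pT 𝔮).comap (algebraMap lam.T mu.T) := h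
    rwa [comap_pT] at this
  · change algebraMap mu.T mu.P (algebraMap lam.T mu.T t) = incl (algebraMap lam.T lam.P t)
    rw [incl_algebraMap, IsScalarTower.algebraMap_apply lam.T mu.T mu.P]

/-- **The ring map `M_T → M_{T′}`** induced by `P_T → P_{T′}`. [folklore] -/
noncomputable def mapMT : lam.MT 𝔮 →+* mu.MT 𝔮 :=
  IsLocalization.map (mu.MT 𝔮) (incl : lam.P →ₐ[lam.T] mu.P).toRingHom (ST_le_comap_ST 𝔮)

/-- `mapMT` on elements of `P_T`. [folklore] -/
theorem mapMT_algebraMap (x : lam.P) :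
    mapMT 𝔮 (lam := lam) (mu := mu) (algebraMap lam.P (lam.MT 𝔮) x) =
      algebraMap mu.P (mu.MT 𝔮) (incl x) :=
  IsLocalization.map_eq (ST_le_comap_ST 𝔮) x

/-- `mapMT` on elements of `T`. [folklore] -/
theorem mapMT_algebraMap_T (t : lam.T) :
    mapMT 𝔮 (lam := lam) (mu := mu) (algebraMap lam.T (lam.MT 𝔮) t) =
      algebraMap mu.T (mu.MT 𝔮) (algebraMap lam.T mu.T t) := by
  rw [IsScalarTower.algebraMap_apply lam.T lam.P (lam.MT 𝔮), mapMT_algebraMap, incl_algebraMap,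
    IsScalarTower.algebraMap_apply lam.T mu.T mu.P,
    ← IsScalarTower.algebraMap_apply mu.T mu.P (mu.MT 𝔮)]

/-! From here on the algebra structure `R_T → R_{T′}` is an instance argument, pinned down by the
scalar tower condition over `T` (in the application it is `algebraRT`). -/

variable [Algebra (lam.RT 𝔮) (mu.RT 𝔮)] [IsScalarTower lam.T (lam.RT 𝔮) (mu.RT 𝔮)]

omit [IsScalarTower lam.T mu.T A] in
/-- `R_T → R_{T′}` on elements of `T`. [folklore] -/
theorem algebraMap_RT_RT_algebraMap (t : lam.T) :
    algebraMap (lam.RT 𝔮) (mu.RT 𝔮) (algebraMap lam.T (lam.RT 𝔮) t) =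
      algebraMap mu.T (mu.RT 𝔮) (algebraMap lam.T mu.T t) := by
  rw [← IsScalarTower.algebraMap_apply, IsScalarTower.algebraMap_apply lam.T mu.T (mu.RT 𝔮)]

/-- `mapMT` is compatible with `R_T → R_{T′}`. [folklore] -/
theorem mapMT_comp_algebraMap :
    (mapMT 𝔮 (lam := lam) (mu := mu)).comp (algebraMap (lam.RT 𝔮) (lam.MT 𝔮)) =
      (algebraMap (mu.RT 𝔮) (mu.MT 𝔮)).comp (algebraMap (lam.RT 𝔮) (mu.RT 𝔮)) := by
  apply IsLocalization.ringHom_ext (lam.pT 𝔮).primeCompl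
  ext t
  rw [RingHom.comp_apply, RingHom.comp_apply, RingHom.comp_apply, RingHom.comp_apply,
    ← IsScalarTower.algebraMap_apply lam.T (lam.RT 𝔮) (lam.MT 𝔮), mapMT_algebraMap_T,
    algebraMap_RT_RT_algebraMap, ← IsScalarTower.algebraMap_apply mu.T (mu.RT 𝔮) (mu.MT 𝔮)]

/-! The composite algebra structure `R_T → M_{T′}` is likewise an instance argument pinned down
by the scalar tower condition. -/

variable [Algebra (lam.RT 𝔮) (mu.MT 𝔮)] [IsScalarTower (lam.RT 𝔮) (mu.RT 𝔮) (mu.MT 𝔮)]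

/-- **`ψ : M_T → M_{T′}`** as an `R_T`-linear map. [folklore] -/
noncomputable def psi : lam.MT 𝔮 →ₗ[lam.RT 𝔮] mu.MT 𝔮 :=
  { toFun := mapMT 𝔮 (lam := lam) (mu := mu)
    map_add' := map_add _
    map_smul' := fun r x => by
      rw [Algebra.smul_def, Algebra.smul_def, map_mul, RingHom.id_apply,
        IsScalarTower.algebraMap_apply (lam.RT 𝔮) (mu.RT 𝔮) (mu.MT 𝔮)]
      congr 1
      exact RingHom.congr_fun (mapMT_comp_algebraMap 𝔮 (lam := lam) (mu := mu)) r }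

/-- `ψ` is `mapMT`. [folklore] -/
theorem psi_apply (x : lam.MT 𝔮) :
    psi 𝔮 (lam := lam) (mu := mu) x = mapMT 𝔮 (lam := lam) (mu := mu) x := rfl

/-- **`M_{T′}` is the base change of `M_T` along `R_T → R_{T′}`** (`P_{T′} = T′ ⊗_T P_T`,
`IsPushout`, and localization commutes with base change, Mathlib's
`isLocalizedModule_iff_isBaseChange`, combined by `IsBaseChange.comp_iff`).
[cite: StacksProject, Tag 00R0 (4)] -/
theorem isBaseChange_psi : IsBaseChange (mu.RT 𝔮) (psi 𝔮 (lam := lam) (mu := mu)) := by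
  letI := algebraPP (lam := lam) (mu := mu)
  haveI := isScalarTower_T_P_P (lam := lam) (mu := mu)
  -- scalar towers over `T`
  haveI hT2 : IsScalarTower lam.T (mu.RT 𝔮) (mu.MT 𝔮) :=
    IsScalarTower.of_algebraMap_eq fun t => by
      rw [IsScalarTower.algebraMap_apply lam.T mu.T (mu.RT 𝔮),
        ← IsScalarTower.algebraMap_apply mu.T (mu.RT 𝔮) (mu.MT 𝔮),
        IsScalarTower.algebraMap_apply lam.T mu.T (mu.MT 𝔮)]
  haveI hT3 : IsScalarTower lam.T (lam.RT 𝔮) (mu.MT 𝔮) :=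
    IsScalarTower.of_algebraMap_eq fun t => by
      rw [IsScalarTower.algebraMap_apply (lam.RT 𝔮) (mu.RT 𝔮) (mu.MT 𝔮),
        ← IsScalarTower.algebraMap_apply lam.T (lam.RT 𝔮) (mu.RT 𝔮),
        ← IsScalarTower.algebraMap_apply lam.T (mu.RT 𝔮) (mu.MT 𝔮)]
  -- the three base changes
  have hf : IsBaseChange (lam.RT 𝔮)
      (IsScalarTower.toAlgHom lam.T lam.P (lam.MT 𝔮)).toLinearMap :=
    (isLocalizedModule_iff_isBaseChange (lam.pT 𝔮).primeCompl (lam.RT 𝔮) _).mp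
      (isLocalizedModule_iff_isLocalization.mpr inferInstance)
  have hg : IsBaseChange (mu.RT 𝔮)
      (IsScalarTower.toAlgHom mu.T mu.P (mu.MT 𝔮)).toLinearMap :=
    (isLocalizedModule_iff_isBaseChange (mu.pT 𝔮).primeCompl (mu.RT 𝔮) _).mp
      (isLocalizedModule_iff_isLocalization.mpr inferInstance)
  have hincl : IsBaseChange mu.T (incl : lam.P →ₐ[lam.T] mu.P).toLinearMap := by
    have h := (isPushout_incl (lam := lam) (mu := mu)).out
    have heq : (IsScalarTower.toAlgHom lam.T lam.P mu.P).toLinearMap =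
        (incl : lam.P →ₐ[lam.T] mu.P).toLinearMap := LinearMap.ext fun _ => rfl
    rwa [heq] at h
  have hcomp := hincl.comp hg
  -- compare the two composites `P_T → M_{T′}`
  have heq : ((psi 𝔮 (lam := lam) (mu := mu)).restrictScalars lam.T) ∘ₗ
      (IsScalarTower.toAlgHom lam.T lam.P (lam.MT 𝔮)).toLinearMap =
      ((IsScalarTower.toAlgHom mu.T mu.P (mu.MT 𝔮)).toLinearMap.restrictScalars lam.T) ∘ₗ
        (incl : lam.P →ₐ[lam.T] mu.P).toLinearMap := by
    apply LinearMap.ext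
    intro x
    exact mapMT_algebraMap 𝔮 (lam := lam) (mu := mu) x
  refine (hf.comp_iff (h := psi 𝔮 (lam := lam) (mu := mu))).mp ?_
  rw [heq]
  exact hcomp

end LE

/-! ### The relation module at level `T` and its normal form at level `∞` -/

section NormalForm

variable (lam : Idx f)

omit [𝔮.IsPrime] in
/-- Generators `a₁, …, a_t` of `𝔭_T` (Noetherian). [folklore] -/
theorem exists_generators_pT :
    ∃ (t : ℕ) (a : Fin t → lam.T), Ideal.span (Set.range a) = lam.pT 𝔮 :=
  haveI := lam.isNoetherianRing
  Submodule.fg_iff_exists_fin_generating_family.mp (IsNoetherian.noetherian _)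

variable {t : ℕ} (a : Fin t → lam.T) (ha : Ideal.span (Set.range a) = lam.pT 𝔮)

include ha in
/-- `πₖ = aₖ/1 ∈ 𝔪_{R_T}`. [folklore] -/
theorem pi_mem (k : Fin t) :
    algebraMap lam.T (lam.RT 𝔮) (a k) ∈ IsLocalRing.maximalIdeal (lam.RT 𝔮) := by
  rw [← Localization.AtPrime.map_eq_maximalIdeal]
  apply Ideal.mem_map_of_mem
  rw [← ha]
  exact Ideal.subset_span ⟨k, rfl⟩

include ha in
/-- `𝔪_{R_T} = (π₁, …, π_t)`. [folklore] -/
theorem span_pi :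
    Ideal.span (Set.range fun k => algebraMap lam.T (lam.RT 𝔮) (a k)) =
      IsLocalRing.maximalIdeal (lam.RT 𝔮) := by
  have h1 : (Ideal.span (Set.range a)).map (algebraMap lam.T (lam.RT 𝔮)) =
      Ideal.span (Set.range fun k => algebraMap lam.T (lam.RT 𝔮) (a k)) := by
    rw [Ideal.map_span, ← Set.range_comp]
    rfl
  rw [← Localization.AtPrime.map_eq_maximalIdeal, ← h1, ha]

include ha in
/-- Every element of `M_T ⊗ 𝔪` is `Σ mₖ ⊗ πₖ`. [folklore] -/
theorem exists_eq_sum_tmul (x : lam.MT 𝔮 ⊗[lam.RT 𝔮] ↥(IsLocalRing.maximalIdeal (lam.RT 𝔮))) :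
    ∃ mv : Fin t → lam.MT 𝔮,
      x = ∑ k, mv k ⊗ₜ[lam.RT 𝔮] (⟨algebraMap lam.T (lam.RT 𝔮) (a k), pi_mem 𝔮 lam a ha k⟩ :
        ↥(IsLocalRing.maximalIdeal (lam.RT 𝔮))) := by
  classical
  induction x using TensorProduct.induction_on with
  | zero => exact ⟨0, by simp⟩
  | add x y hx hy =>
    obtain ⟨m₁, rfl⟩ := hx
    obtain ⟨m₂, rfl⟩ := hy
    refine ⟨m₁ + m₂, ?_⟩
    rw [← Finset.sum_add_distrib]
    exact Finset.sum_congr rfl fun k _ => by rw [Pi.add_apply, TensorProduct.add_tmul]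
  | tmul mm i =>
    have hi : (i : lam.RT 𝔮) ∈ Ideal.span (Set.range fun k => algebraMap lam.T (lam.RT 𝔮) (a k)) := by
      rw [span_pi 𝔮 lam a ha]; exact i.2
    obtain ⟨c, hc⟩ := Ideal.mem_span_range_iff_exists_fun.mp hi
    refine ⟨fun k => c k • mm, ?_⟩
    have : i = ∑ k, c k • (⟨algebraMap lam.T (lam.RT 𝔮) (a k), pi_mem 𝔮 lam a ha k⟩ :
        ↥(IsLocalRing.maximalIdeal (lam.RT 𝔮))) := by
      apply Subtype.ext
      rw [← hc]
      simp
    conv_lhs => rw [this, TensorProduct.tmul_sum]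
    exact Finset.sum_congr rfl fun k _ => by rw [TensorProduct.smul_tmul]

/-- `M ⊗ 𝔪 → M` on `Σ mₖ ⊗ πₖ` is `Σ πₖ mₖ`. [folklore] -/
theorem smulMap_sum_tmul (mv : Fin t → lam.MT 𝔮) :
    smulMap (IsLocalRing.maximalIdeal (lam.RT 𝔮)) (lam.MT 𝔮)
      (∑ k, mv k ⊗ₜ[lam.RT 𝔮] (⟨algebraMap lam.T (lam.RT 𝔮) (a k), pi_mem 𝔮 lam a ha k⟩ :
        ↥(IsLocalRing.maximalIdeal (lam.RT 𝔮)))) =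
      ∑ k, algebraMap lam.T (lam.RT 𝔮) (a k) • mv k := by
  rw [map_sum]
  exact Finset.sum_congr rfl fun k _ => by rw [smulMap_tmul]

/-- **The normal form, at level `∞`, of a relation `Σ πₖ mₖ = 0` in `M_T`** (from the equational
criterion of flatness for the flat `A_𝔭`-module `(A[x]/(f))_𝔭`, Mathlib's
`Module.Flat.isTrivialRelation_of_sum_smul_eq_zero`, after clearing denominators):
there are `u, w ∉ 𝔭`, `b_{kj} ∈ A`, `Z_j ∈ A[x]` such that, with `mₖ = q̄ₖ/tₖ`, for each `k`
`c_k (u w qₖ − tₖ Σ_j b_{kj} Z_j) = Σ_i G_{ki} fᵢ` in `A[x]` for some `c_k ∉ 𝔭`, `G_{ki} ∈ A[x]`,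
and for each `j`, `d_j Σ_k a_k b_{kj} = 0` in `A` for some `d_j ∉ 𝔭`.
[cite: StacksProject, Tag 00R6 (proof)] -/
theorem exists_normalForm [Module.Flat A (Pinf f)] (q : Fin t → MvPolynomial (Fin n) lam.T)
    (tt : Fin t → lam.T) (htt : ∀ k, tt k ∉ lam.pT 𝔮)
    (hrel : ∑ k, algebraMap lam.T (lam.RT 𝔮) (a k) •
      IsLocalization.mk' (lam.MT 𝔮) (lam.mkP (q k))
        (⟨algebraMap lam.T lam.P (tt k), tt k, htt k, rfl⟩ : lam.ST 𝔮) = 0) :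
    ∃ (u w : A) (_ : u ∉ pA 𝔮) (_ : w ∉ pA 𝔮) (kk : ℕ) (b : Fin t → Fin kk → A)
      (Z : Fin kk → MvPolynomial (Fin n) A) (c : Fin t → A) (_ : ∀ k, c k ∉ pA 𝔮)
      (G : Fin t → Fin m → MvPolynomial (Fin n) A) (d : Fin kk → A) (_ : ∀ j, d j ∉ pA 𝔮),
      (∀ k, MvPolynomial.C (c k) * (MvPolynomial.C u * MvPolynomial.C w *
          MvPolynomial.map (algebraMap lam.T A) (q k) -
        MvPolynomial.C (tt k : A) * ∑ j, MvPolynomial.C (b k j) * Z j) = ∑ i, G k i * f i) ∧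
      (∀ j, d j * ∑ k, (a k : A) * b k j = 0) := by
  classical
  -- notation at level `∞`
  let R := lam.RT 𝔮
  let M := lam.MT 𝔮
  let π : Fin t → R := fun k => algebraMap lam.T R (a k)
  let sk : Fin t → lam.ST 𝔮 := fun k => ⟨algebraMap lam.T lam.P (tt k), tt k, htt k, rfl⟩
  let mv : Fin t → M := fun k => IsLocalization.mk' M (lam.mkP (q k)) (sk k)
  let πi : Fin t → Rinf 𝔮 := fun k => algebraMap R (Rinf 𝔮) (π k)
  let mvi : Fin t → Minf 𝔮 := fun k => algebraMap M (Minf 𝔮) (mv k)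
  have hπi : ∀ k, πi k = algebraMap A (Rinf 𝔮) (a k) := fun k => by
    change algebraMap R (Rinf 𝔮) (algebraMap lam.T R (a k)) = _
    rw [← IsScalarTower.algebraMap_apply]
    rfl
  -- the relation, mapped to `M_∞`
  have hreli : ∑ k, πi k • mvi k = 0 := by
    have h := congrArg (algebraMap M (Minf 𝔮)) hrel
    rw [map_zero, map_sum] at h
    rw [← h]
    refine Finset.sum_congr rfl fun k _ => ?_
    change algebraMap (Rinf 𝔮) (Minf 𝔮) (algebraMap R (Rinf 𝔮) (π k)) * algebraMap M (Minf 𝔮) (mv k) =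
      algebraMap M (Minf 𝔮) (π k • mv k)
    rw [Algebra.smul_def, map_mul, ← RingHom.comp_apply, ← algebraMap_MT_Minf_comp,
      RingHom.comp_apply]
  -- equational criterion
  haveI := flat_Minf 𝔮 (f := f)
  obtain ⟨kk, acoef, y, hy1, hy2⟩ := Module.Flat.isTrivialRelation_of_sum_smul_eq_zero hreli
  -- clear denominators of the `acoef k j` and of the `y j`
  obtain ⟨U, hU⟩ := IsLocalization.exist_integer_multiples_of_finite (pA 𝔮).primeCompl
    (fun kj : Fin t × Fin kk => acoef kj.1 kj.2)
  have hb : ∀ k j, ∃ b : A, algebraMap A (Rinf 𝔮) b = (U : A) • acoef k j := fun k j =>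
    RingHom.mem_rangeS.mp (hU (k, j))
  choose b hb using hb
  obtain ⟨Wd, hWd⟩ := IsLocalization.exist_integer_multiples_of_finite (Sinf 𝔮) y
  obtain ⟨w, hw, hWdw⟩ : ∃ w ∈ (pA 𝔮).primeCompl, algebraMap A (Pinf f) w = (Wd : Pinf f) :=
    Submonoid.mem_map.mp Wd.2
  have hz : ∀ j, ∃ Z : MvPolynomial (Fin n) A,
      algebraMap (Pinf f) (Minf 𝔮) (Pinf.mk Z) = (Wd : Pinf f) • y j := fun j => by
    obtain ⟨z, hz⟩ := RingHom.mem_rangeS.mp (hWd j)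
    obtain ⟨Z, rfl⟩ := Pinf.mk_surjective (f := f) z
    exact ⟨Z, hz⟩
  choose Z hZ using hz
  -- images of the `mv k`
  have hmvi : ∀ k, mvi k = IsLocalization.mk' (Minf 𝔮) (Pinf.mk (MvPolynomial.map (algebraMap lam.T A) (q k)))
      (⟨algebraMap A (Pinf f) (tt k), (tt k : A), fun h => htt k (by
        rw [pT_eq_comap_pA]; exact h), rfl⟩ : Sinf 𝔮) := fun k => by
    change algebraMap M (Minf 𝔮) (IsLocalization.mk' M (lam.mkP (q k)) (sk k)) = _
    rw [algebraMap_MT_Minf, IsLocalization.map_mk']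
    congr 1
    apply Subtype.ext
    exact toPinf_algebraMap lam (tt k)
  -- (I_k): the identities for the `mv k`
  have hI : ∀ k, ∃ (c : A) (_ : c ∉ pA 𝔮) (G : Fin m → MvPolynomial (Fin n) A),
      MvPolynomial.C c * (MvPolynomial.C (U : A) * MvPolynomial.C w *
          MvPolynomial.map (algebraMap lam.T A) (q k) -
        MvPolynomial.C (tt k : A) * ∑ j, MvPolynomial.C (b k j) * Z j) = ∑ i, G i * f i := by
    intro k
    -- `u w mvᵢ k = Σ_j b_{kj} z_j` in `M_∞`
    have key : algebraMap (Pinf f) (Minf 𝔮) (algebraMap A (Pinf f) (U : A) * algebraMap A (Pinf f) w) *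
        mvi k = algebraMap (Pinf f) (Minf 𝔮) (∑ j, algebraMap A (Pinf f) (b k j) * Pinf.mk (Z j)) := by
      rw [hy1 k, Finset.mul_sum, map_sum]
      refine Finset.sum_congr rfl fun j _ => ?_
      rw [map_mul, map_mul, hZ j, Algebra.smul_def (acoef k j), Algebra.smul_def (Wd : Pinf f),
        ← hWdw]
      have hbkj : algebraMap A (Minf 𝔮) (b k j) =
          algebraMap (Rinf 𝔮) (Minf 𝔮) (algebraMap A (Rinf 𝔮) (U : A) * acoef k j) := by
        rw [← Algebra.smul_def, ← hb k j, ← IsScalarTower.algebraMap_apply]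
      have e1 : algebraMap (Pinf f) (Minf 𝔮) (algebraMap A (Pinf f) (U : A)) =
          algebraMap (Rinf 𝔮) (Minf 𝔮) (algebraMap A (Rinf 𝔮) (U : A)) := by
        rw [← IsScalarTower.algebraMap_apply, ← IsScalarTower.algebraMap_apply]
      have e2 : algebraMap (Pinf f) (Minf 𝔮) (algebraMap A (Pinf f) (b k j)) =
          algebraMap A (Minf 𝔮) (b k j) := by rw [← IsScalarTower.algebraMap_apply]
      rw [e1, e2, hbkj, map_mul]
      ring
    rw [hmvi k, IsLocalization.mul_mk'_eq_mk'_of_mul, ← IsLocalization.mk'_one (M := Sinf 𝔮),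
      IsLocalization.eq] at key
    obtain ⟨cc, hcc⟩ := key
    obtain ⟨c, hc, hccc⟩ : ∃ c ∈ (pA 𝔮).primeCompl, algebraMap A (Pinf f) c = (cc : Pinf f) :=
      Submonoid.mem_map.mp cc.2
    refine ⟨c, hc, ?_⟩
    -- `hcc` is an identity in `A[x]/(f)`; lift it to `A[x]`
    have hmem : MvPolynomial.C c * (MvPolynomial.C (U : A) * MvPolynomial.C w *
          MvPolynomial.map (algebraMap lam.T A) (q k) -
        MvPolynomial.C (tt k : A) * ∑ j, MvPolynomial.C (b k j) * Z j) ∈ Ideal.span (Set.range f) := by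
      rw [← Ideal.Quotient.eq_zero_iff_mem]
      change Pinf.mk _ = 0
      simp only [map_mul, map_sub, map_sum]
      have hC : ∀ x : A, Pinf.mk (f := f) (MvPolynomial.C x) = algebraMap A (Pinf f) x := fun x => rfl
      simp only [hC]
      rw [← hccc] at hcc
      simp only [OneMemClass.coe_one, one_mul] at hcc
      rw [mul_sub, hcc, sub_self]
    exact Ideal.mem_span_range_iff_exists_fun.mp hmem |>.imp fun G hG => hG.symm
  choose c hc G hG using hI
  -- (II_j): the identities for the `acoef`
  have hII : ∀ j, ∃ (d : A) (_ : d ∉ pA 𝔮), d * ∑ k, (a k : A) * b k j = 0 := by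
    intro j
    have key : algebraMap A (Rinf 𝔮) (∑ k, (a k : A) * b k j) = 0 := by
      rw [map_sum]
      have : ∑ k, algebraMap A (Rinf 𝔮) ((a k : A) * b k j) =
          algebraMap A (Rinf 𝔮) (U : A) * ∑ k, πi k * acoef k j := by
        rw [Finset.mul_sum]
        refine Finset.sum_congr rfl fun k _ => ?_
        rw [map_mul, hb k j, Algebra.smul_def, hπi k]
        ring
      rw [this, hy2 j, mul_zero]
    obtain ⟨d, hd⟩ := (IsLocalization.map_eq_zero_iff (pA 𝔮).primeCompl (Rinf 𝔮) _).mp key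
    exact ⟨d, d.2, hd⟩
  choose d hd hdd using hII
  exact ⟨U, w, U.2, hw, kk, b, Z, c, hc, G, d, hd, hG, hdd⟩

end NormalForm

/-! ### Vanishing of `θ′` on a relation in normal form, at a level containing the coefficients -/

omit [𝔮.IsPrime] in
/-- Sums of fractions with a common denominator. [folklore] -/
theorem sum_mk' {R S : Type*} [CommRing R] [CommRing S] [Algebra R S] {M : Submonoid R}
    [IsLocalization M S] {ι : Type*} (s : Finset ι) (x : ι → R) (y : M) :
    ∑ i ∈ s, IsLocalization.mk' S (x i) y = IsLocalization.mk' S (∑ i ∈ s, x i) y := by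
  rw [IsLocalization.mk'_eq_mul_mk'_one (∑ i ∈ s, x i) y, map_sum, Finset.sum_mul]
  exact Finset.sum_congr rfl fun i _ => IsLocalization.mk'_eq_mul_mk'_one (x i) y

section ThetaVanishing

variable {lam mu : Idx f} [Algebra lam.T mu.T] [IsScalarTower lam.T mu.T A]
variable [Algebra (lam.RT 𝔮) (mu.RT 𝔮)] [IsScalarTower lam.T (lam.RT 𝔮) (mu.RT 𝔮)]
variable [Algebra (lam.RT 𝔮) (mu.MT 𝔮)] [IsScalarTower (lam.RT 𝔮) (mu.RT 𝔮) (mu.MT 𝔮)]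
variable {t : ℕ} (a : Fin t → lam.T) (ha : Ideal.span (Set.range a) = lam.pT 𝔮)

set_option maxHeartbeats 1000000 in
/-- **`θ′` kills a relation whose normal form has coefficients in `T′`.** With the data of
`exists_normalForm` lying in `T′ ⊇ T`, the element `Σₖ mₖ ⊗ πₖ` of `M_T ⊗ 𝔪_{R_T}` is mapped to
`0` in `M_{T′} ⊗_{R_{T′}} 𝔪_{R_T}R_{T′}`: at level `T′`, `ψ(mₖ) = Σ_j a_{kj} y_j` with
`Σ_k πₖ a_{kj} = 0`, so `Σₖ ψ(mₖ) ⊗ πₖ = Σ_j y_j ⊗ (Σₖ a_{kj} πₖ) = 0` (The Stacks Project, Tag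
00R6, the step "`ξᵢ` maps to zero"). [cite: StacksProject, Tag 00R6 (proof)] -/
theorem theta_eq_zero_of_normalForm
    (q : Fin t → MvPolynomial (Fin n) lam.T) (tt : Fin t → lam.T) (htt : ∀ k, tt k ∉ lam.pT 𝔮)
    {kk : ℕ} (u w : A) (hu : u ∉ pA 𝔮) (hw : w ∉ pA 𝔮) (b : Fin t → Fin kk → A)
    (Z : Fin kk → MvPolynomial (Fin n) A) (c : Fin t → A) (hc : ∀ k, c k ∉ pA 𝔮)
    (G : Fin t → Fin m → MvPolynomial (Fin n) A) (d : Fin kk → A) (hd : ∀ j, d j ∉ pA 𝔮)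
    (hI : ∀ k, MvPolynomial.C (c k) * (MvPolynomial.C u * MvPolynomial.C w *
        MvPolynomial.map (algebraMap lam.T A) (q k) -
      MvPolynomial.C (tt k : A) * ∑ j, MvPolynomial.C (b k j) * Z j) = ∑ i, G k i * f i)
    (hII : ∀ j, d j * ∑ k, (a k : A) * b k j = 0)
    (huT : u ∈ mu.T) (hwT : w ∈ mu.T) (hbT : ∀ k j, b k j ∈ mu.T) (hcT : ∀ k, c k ∈ mu.T)
    (hdT : ∀ j, d j ∈ mu.T) (hZT : ∀ j, ((Z j).coeffs : Set A) ⊆ mu.T)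
    (hGT : ∀ k i, ((G k i).coeffs : Set A) ⊆ mu.T) :
    baseChangeTor' (IsLocalRing.maximalIdeal (lam.RT 𝔮)) (psi 𝔮 (lam := lam) (mu := mu))
        (isBaseChange_psi 𝔮)
      (∑ k, IsLocalization.mk' (lam.MT 𝔮) (lam.mkP (q k))
          (⟨algebraMap lam.T lam.P (tt k), tt k, htt k, rfl⟩ : lam.ST 𝔮) ⊗ₜ[lam.RT 𝔮]
        (⟨algebraMap lam.T (lam.RT 𝔮) (a k), pi_mem 𝔮 lam a ha k⟩ :
          ↥(IsLocalRing.maximalIdeal (lam.RT 𝔮)))) = 0 := by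
  classical
  -- level-`T′` data
  let u' : mu.T := ⟨u, huT⟩
  let w' : mu.T := ⟨w, hwT⟩
  let b' : Fin t → Fin kk → mu.T := fun k j => ⟨b k j, hbT k j⟩
  let c' : Fin t → mu.T := fun k => ⟨c k, hcT k⟩
  let d' : Fin kk → mu.T := fun j => ⟨d j, hdT j⟩
  let a' : Fin t → mu.T := fun k => algebraMap lam.T mu.T (a k)
  let tt' : Fin t → mu.T := fun k => algebraMap lam.T mu.T (tt k)
  let q' : Fin t → MvPolynomial (Fin n) mu.T := fun k => MvPolynomial.map (algebraMap lam.T mu.T) (q k)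
  have hmem : ∀ x : mu.T, (x : A) ∉ pA 𝔮 → x ∉ mu.pT 𝔮 := fun x hx h =>
    hx (by rw [pT_eq_comap_pA] at h; exact h)
  have hu' : u' ∉ mu.pT 𝔮 := hmem u' hu
  have hw' : w' ∉ mu.pT 𝔮 := hmem w' hw
  have hc' : ∀ k, c' k ∉ mu.pT 𝔮 := fun k => hmem (c' k) (hc k)
  have hd' : ∀ j, d' j ∉ mu.pT 𝔮 := fun j => hmem (d' j) (hd j)
  have htt' : ∀ k, tt' k ∉ mu.pT 𝔮 := fun k h => htt k (by
    have : tt k ∈ (mu.pT 𝔮).comap (algebraMap lam.T mu.T) := h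
    rwa [comap_pT] at this)
  have hZ' : ∀ j, ∃ Z' : MvPolynomial (Fin n) mu.T,
      MvPolynomial.map (algebraMap mu.T A) Z' = Z j := fun j => by
    have : Z j ∈ Set.range (MvPolynomial.map (algebraMap mu.T A)) := by
      rw [MvPolynomial.mem_range_map_iff_coeffs_subset, Subalgebra.setRange_algebraMap]; exact hZT j
    exact this
  choose Z' hZ' using hZ'
  have hG' : ∀ k i, ∃ G' : MvPolynomial (Fin n) mu.T,
      MvPolynomial.map (algebraMap mu.T A) G' = G k i := fun k i => by
    have : G k i ∈ Set.range (MvPolynomial.map (algebraMap mu.T A)) := by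
      rw [MvPolynomial.mem_range_map_iff_coeffs_subset, Subalgebra.setRange_algebraMap]; exact hGT k i
    exact this
  choose G' hG' using hG'
  -- (I′): the polynomial identities at level `T′`
  have hI' : ∀ k, MvPolynomial.C (c' k) * (MvPolynomial.C u' * MvPolynomial.C w' * q' k -
      MvPolynomial.C (tt' k) * ∑ j, MvPolynomial.C (b' k j) * Z' j) = ∑ i, G' k i * mu.res i := by
    intro k
    apply MvPolynomial.map_injective _ mu.algebraMap_injective
    simp only [map_mul, map_sub, map_sum, MvPolynomial.map_C, map_res, hZ', hG', q',
      MvPolynomial.map_map, ← IsScalarTower.algebraMap_eq]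
    have e1 : algebraMap mu.T A (tt' k) = (tt k : A) := coe_algebraMap (tt k)
    rw [e1]
    exact hI k
  -- (II′): the identities in `T′`
  have hII' : ∀ j, d' j * ∑ k, a' k * b' k j = 0 := by
    intro j
    apply mu.algebraMap_injective
    rw [map_mul, map_sum, map_zero]
    have : ∑ k, algebraMap mu.T A (a' k * b' k j) = ∑ k, (a k : A) * b k j :=
      Finset.sum_congr rfl fun k _ => by rw [map_mul]; exact congrArg₂ (· * ·) (coe_algebraMap (a k)) rfl
    rw [this]
    exact hII j
  -- the identity in `P_{T′}`
  have hP : ∀ k, algebraMap mu.T mu.P (c' k) * ((algebraMap mu.T mu.P u' * algebraMap mu.T mu.P w') *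
      mu.mkP (q' k)) = algebraMap mu.T mu.P (c' k) *
        (algebraMap mu.T mu.P (tt' k) * ∑ j, algebraMap mu.T mu.P (b' k j) * mu.mkP (Z' j)) := by
    intro k
    have h := congrArg mu.mkP (hI' k)
    rw [map_sum] at h
    have h0 : ∑ i, mu.mkP (G' k i * mu.res i) = 0 :=
      Finset.sum_eq_zero fun i _ => by rw [map_mul, mkP_res, mul_zero]
    rw [h0, map_mul, map_sub] at h
    have hC : ∀ x : mu.T, mu.mkP (MvPolynomial.C x) = algebraMap mu.T mu.P x := fun x => rfl
    simp only [map_mul, map_sum, hC] at h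
    rw [← sub_eq_zero, ← mul_sub]
    exact h
  -- the level-`T′` coefficients and vectors
  let sw : mu.ST 𝔮 := ⟨algebraMap mu.T mu.P w', w', hw', rfl⟩
  let amu : Fin t → Fin kk → mu.RT 𝔮 := fun k j =>
    IsLocalization.mk' (M := (mu.pT 𝔮).primeCompl) (mu.RT 𝔮) (b' k j) ⟨u', hu'⟩
  let ymu : Fin kk → mu.MT 𝔮 := fun j => IsLocalization.mk' (mu.MT 𝔮) (mu.mkP (Z' j)) sw
  let πmu : Fin t → mu.RT 𝔮 := fun k => algebraMap mu.T (mu.RT 𝔮) (a' k)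
  have hπmu : ∀ k, algebraMap (lam.RT 𝔮) (mu.RT 𝔮) (algebraMap lam.T (lam.RT 𝔮) (a k)) = πmu k :=
    fun k => algebraMap_RT_RT_algebraMap 𝔮 (a k)
  -- (E2)
  have hE2 : ∀ j, ∑ k, πmu k * amu k j = 0 := by
    intro j
    have : ∑ k, πmu k * amu k j =
        IsLocalization.mk' (M := (mu.pT 𝔮).primeCompl) (mu.RT 𝔮) (∑ k, a' k * b' k j) ⟨u', hu'⟩ := by
      rw [← sum_mk']
      exact Finset.sum_congr rfl fun k _ => IsLocalization.mul_mk'_eq_mk'_of_mul _ _ _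
    rw [this, IsLocalization.mk'_eq_zero_iff]
    exact ⟨⟨d' j, hd' j⟩, hII' j⟩
  -- (E1)
  have hE1 : ∀ k, psi 𝔮 (lam := lam) (mu := mu)
      (IsLocalization.mk' (lam.MT 𝔮) (lam.mkP (q k))
        (⟨algebraMap lam.T lam.P (tt k), tt k, htt k, rfl⟩ : lam.ST 𝔮)) = ∑ j, amu k j • ymu j := by
    intro k
    rw [psi_apply, mapMT, IsLocalization.map_mk']
    -- right-hand side as a single fraction
    have hsum : ∑ j, amu k j • ymu j = IsLocalization.mk' (mu.MT 𝔮)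
        (∑ j, algebraMap mu.T mu.P (b' k j) * mu.mkP (Z' j))
        (⟨algebraMap mu.T mu.P u' * algebraMap mu.T mu.P w', u' * w',
          (mu.pT 𝔮).primeCompl.mul_mem hu' hw', by rw [map_mul]⟩ : mu.ST 𝔮) := by
      rw [← sum_mk']
      refine Finset.sum_congr rfl fun j _ => ?_
      rw [Algebra.smul_def, IsLocalization.algebraMap_mk' mu.P (mu.RT 𝔮) (mu.MT 𝔮),
        ← IsLocalization.mk'_mul]
      rfl
    rw [hsum, IsLocalization.eq]
    refine ⟨⟨algebraMap mu.T mu.P (c' k), c' k, hc' k, rfl⟩, ?_⟩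
    change algebraMap mu.T mu.P (c' k) * (algebraMap mu.T mu.P u' * algebraMap mu.T mu.P w' *
      (incl : lam.P →ₐ[lam.T] mu.P) (lam.mkP (q k))) = algebraMap mu.T mu.P (c' k) *
        ((incl : lam.P →ₐ[lam.T] mu.P) (algebraMap lam.T lam.P (tt k)) *
          ∑ j, algebraMap mu.T mu.P (b' k j) * mu.mkP (Z' j))
    rw [incl_mkP, incl_algebraMap, IsScalarTower.algebraMap_apply lam.T mu.T mu.P]
    exact hP k
  -- the computation of `θ′`
  rw [map_sum]
  have hπI : ∀ k, mulMapIdeal (IsLocalRing.maximalIdeal (lam.RT 𝔮))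
      ((1 : mu.RT 𝔮) ⊗ₜ[lam.RT 𝔮] (⟨algebraMap lam.T (lam.RT 𝔮) (a k), pi_mem 𝔮 lam a ha k⟩ :
        ↥(IsLocalRing.maximalIdeal (lam.RT 𝔮)))) =
      ⟨πmu k, by rw [← hπmu]; exact Ideal.mem_map_of_mem _ (pi_mem 𝔮 lam a ha k)⟩ := fun k => by
    apply Subtype.ext
    rw [mulMapIdeal_tmul_coe, Algebra.smul_def, mul_one]
    exact hπmu k
  simp only [baseChangeTor'_tmul, hE1, hπI, TensorProduct.sum_tmul, TensorProduct.smul_tmul]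
  rw [Finset.sum_comm]
  refine Finset.sum_eq_zero fun j _ => ?_
  rw [← TensorProduct.tmul_sum]
  have h0 : ∑ k, amu k j • (⟨πmu k, by rw [← hπmu]; exact Ideal.mem_map_of_mem _ (pi_mem 𝔮 lam a ha k)⟩ :
      ↥((IsLocalRing.maximalIdeal (lam.RT 𝔮)).map (algebraMap (lam.RT 𝔮) (mu.RT 𝔮)))) = 0 := by
    apply Subtype.ext
    rw [AddSubmonoidClass.coe_finsetSum, ZeroMemClass.coe_zero, ← hE2 j]
    refine Finset.sum_congr rfl fun k _ => ?_
    rw [SetLike.val_smul, smul_eq_mul, mul_comm]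
  rw [h0, TensorProduct.tmul_zero]

end ThetaVanishing

/-! ### Transport of injectivity along a flat extension of the coefficient ring -/

omit [𝔮.IsPrime] in
/-- If `A` is an `R`-algebra, `N` a flat `A`-module and `X → Y` an `R`-linear map such that
`A ⊗_R X → A ⊗_R Y` is injective, then `N ⊗_R X → N ⊗_R Y` is injective
(`N ⊗_R X = N ⊗_A (A ⊗_R X)`). [folklore] -/
theorem injective_lTensor_of_flat {R A Nn X Y : Type*} [CommRing R] [CommRing A] [Algebra R A]
    [AddCommGroup Nn] [Module R Nn] [Module A Nn] [IsScalarTower R A Nn] [Module.Flat A Nn]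
    [AddCommGroup X] [Module R X] [AddCommGroup Y] [Module R Y] (g : X →ₗ[R] Y)
    (hg : Function.Injective (g.lTensor A)) : Function.Injective (g.lTensor Nn) := by
  let gA : A ⊗[R] X →ₗ[A] A ⊗[R] Y := TensorProduct.AlgebraTensorModule.lTensor A A g
  have hgA : Function.Injective gA := hg
  have h1 : Function.Injective (gA.lTensor Nn) := Module.Flat.lTensor_preserves_injective_linearMap _ hgA
  let eX := TensorProduct.AlgebraTensorModule.cancelBaseChange R A A Nn X
  let eY := TensorProduct.AlgebraTensorModule.cancelBaseChange R A A Nn Y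
  have hcomm : ∀ z, eY (gA.lTensor Nn z) = g.lTensor Nn (eX z) := by
    intro z
    induction z using TensorProduct.induction_on with
    | zero => simp
    | add x y hx hy => simp [hx, hy]
    | tmul nn v =>
      induction v using TensorProduct.induction_on with
      | zero => simp
      | add x y hx hy =>
        simp only [LinearMap.lTensor_tmul, map_add, TensorProduct.tmul_add] at hx hy ⊢
        rw [hx, hy]
      | tmul c x => simp [eX, eY, gA]
  intro z₁ z₂ hz
  obtain ⟨y₁, rfl⟩ := eX.surjective z₁
  obtain ⟨y₂, rfl⟩ := eX.surjective z₂
  rw [← hcomm, ← hcomm] at hz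
  rw [h1 (eY.injective hz)]


omit [𝔮.IsPrime] in
/-- `(S ⊗_R M) ⊗_S Z ≃ M ⊗_R Z` (additively), `(s ⊗ m) ⊗ z ↦ m ⊗ s z`. [folklore] -/
theorem exists_baseChangeTensorAddEquiv (R S M Z : Type*) [CommRing R] [CommRing S] [Algebra R S]
    [AddCommGroup M] [Module R M] [AddCommGroup Z] [Module R Z] [Module S Z]
    [IsScalarTower R S Z] :
    ∃ Φ : (S ⊗[R] M) ⊗[S] Z ≃+ M ⊗[R] Z, ∀ (s : S) (m : M) (z : Z),
      Φ ((s ⊗ₜ[R] m) ⊗ₜ[S] z) = m ⊗ₜ[R] (s • z) :=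
  ⟨(TensorProduct.comm S (S ⊗[R] M) Z).toAddEquiv.trans
    ((TensorProduct.AlgebraTensorModule.cancelBaseChange R S S Z M).toAddEquiv.trans
      (TensorProduct.comm R Z M).toAddEquiv), fun s m z => by simp⟩

omit [𝔮.IsPrime] in
/-- **Injectivity of `N ⊗_S X → N ⊗_S Y` from that of `M ⊗_R X → M ⊗_R Y` when `N = S ⊗_R M`**
(`N ⊗_S Z = M ⊗_R Z` naturally in the `S`-module `Z`). [folklore] -/
theorem injective_lTensor_of_isBaseChange {R S M Nn X Y : Type*} [CommRing R] [CommRing S]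
    [Algebra R S] [AddCommGroup M] [Module R M] [AddCommGroup Nn] [Module R Nn] [Module S Nn]
    [IsScalarTower R S Nn] {f : M →ₗ[R] Nn} (hf : IsBaseChange S f)
    [AddCommGroup X] [Module R X] [Module S X] [IsScalarTower R S X]
    [AddCommGroup Y] [Module R Y] [Module S Y] [IsScalarTower R S Y] (ι : X →ₗ[S] Y)
    (h : Function.Injective ((ι.restrictScalars R).lTensor M)) :
    Function.Injective (ι.lTensor Nn) := by
  obtain ⟨ΦX, hΦX⟩ := exists_baseChangeTensorAddEquiv R S M X
  obtain ⟨ΦY, hΦY⟩ := exists_baseChangeTensorAddEquiv R S M Y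
  let e : S ⊗[R] M ≃ₗ[S] Nn := hf.equiv
  let cX : Nn ⊗[S] X ≃ₗ[S] (S ⊗[R] M) ⊗[S] X := TensorProduct.congr e.symm (LinearEquiv.refl S X)
  let cY : Nn ⊗[S] Y ≃ₗ[S] (S ⊗[R] M) ⊗[S] Y := TensorProduct.congr e.symm (LinearEquiv.refl S Y)
  -- naturality of `Φ` in `Z`
  have hnat : ∀ w : (S ⊗[R] M) ⊗[S] X,
      ΦY (ι.lTensor (S ⊗[R] M) w) = (ι.restrictScalars R).lTensor M (ΦX w) := by
    intro w
    induction w using TensorProduct.induction_on with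
    | zero => rw [map_zero, map_zero, map_zero, map_zero]
    | add x y hx hy => rw [map_add, map_add, hx, hy, map_add, map_add]
    | tmul v x =>
      induction v using TensorProduct.induction_on with
      | zero => rw [TensorProduct.zero_tmul, map_zero, map_zero, map_zero, map_zero]
      | add v₁ v₂ h₁ h₂ =>
        rw [TensorProduct.add_tmul, map_add, map_add, map_add, map_add, h₁, h₂]
      | tmul s m =>
        rw [LinearMap.lTensor_tmul, hΦY, hΦX, LinearMap.lTensor_tmul, LinearMap.restrictScalars_apply,
          map_smul]
  -- the square for `N`
  have hsq : ∀ t : Nn ⊗[S] X, ΦY (cY (ι.lTensor Nn t)) = (ι.restrictScalars R).lTensor M (ΦX (cX t)) := by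
    intro t
    rw [← hnat]
    congr 1
    induction t using TensorProduct.induction_on with
    | zero => rw [map_zero, map_zero, map_zero, map_zero]
    | add x y hx hy => rw [map_add, map_add, hx, hy, map_add, map_add]
    | tmul nn x => simp [cX, cY]
  intro t₁ t₂ ht
  have := congrArg (fun t => ΦY (cY t)) ht
  simp only [hsq] at this
  exact cX.injective (ΦX.injective (h this))


omit [𝔮.IsPrime] in
/-- **The abstract level-`T′` step** (The Stacks Project, Tag 00MO combined with Tag 00MK, for a
flat `M′`-algebra `N`): let `R` be a local ring with maximal ideal `𝔪`, `R → R′`, `M′ = R′ ⊗_R M`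
(`IsBaseChange`), `N` a Noetherian `R′`-algebra which is a flat `M′`-algebra, such that
`𝔪N ⊆ rad(N)` and `M′ ⊗_{R′} 𝔪R′ → M′` is injective. Then `N` is flat over `R′`: by flatness of
`N` over `M′` the injectivity passes to `N`, and `N/𝔪N` is flat over `R′/𝔪R′` because
`M′ ⊗_{R′} (-) = M ⊗_R (-)` on `R′/𝔪R′`-modules, which are `R/𝔪`-vector spaces; conclude by the
local criterion `flat_of_le_jacobson`. [cite: StacksProject, Tag 00MO] -/
theorem flat_of_isBaseChange_of_injective {R R' M M' N : Type*} [CommRing R] [IsLocalRing R]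
    [CommRing R'] [Algebra R R'] [IsNoetherianRing R'] [AddCommGroup M] [Module R M]
    [CommRing M'] [Algebra R' M'] [Module R M'] [IsScalarTower R R' M']
    {ψ : M →ₗ[R] M'} (hψ : IsBaseChange R' ψ)
    [CommRing N] [Algebra R' N] [Algebra M' N] [IsScalarTower R' M' N] [IsNoetherianRing N]
    [Module.Flat M' N]
    (hinj : Function.Injective (LinearMap.lTensor M'
      ((IsLocalRing.maximalIdeal R).map (algebraMap R R')).subtype))
    (hJ : ((IsLocalRing.maximalIdeal R).map (algebraMap R R')).map (algebraMap R' N) ≤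
      (⊥ : Ideal N).jacobson) :
    Module.Flat R' N := by
  let I := IsLocalRing.maximalIdeal R
  let J : Ideal R' := I.map (algebraMap R R')
  -- (hi)
  have hinj' : Function.Injective (LinearMap.lTensor M' J.subtype) := hinj
  have hi : Function.Injective (LinearMap.lTensor N J.subtype) :=
    @injective_lTensor_of_flat R' M' N (↥J) R' _ _ _ _ _ _ _ _ _ _ _ _ J.subtype hinj'
  -- (hii): through `M ⊗_R (-)` and the residue field `κ = R/𝔪`
  let Rb := R' ⧸ J
  let κ := R ⧸ I
  have hIJ : ∀ x ∈ I, ((Ideal.Quotient.mk J).comp (algebraMap R R')) x = 0 :=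
    fun x hx => Ideal.Quotient.eq_zero_iff_mem.mpr (Ideal.mem_map_of_mem _ hx)
  let φ : κ →+* Rb := Ideal.Quotient.lift I ((Ideal.Quotient.mk J).comp (algebraMap R R')) hIJ
  letI := RingHom.toAlgebra (R := κ) (S := Rb) φ
  haveI : IsScalarTower R κ Rb :=
    IsScalarTower.of_algebraMap_eq (R := R) (S := κ) (A := Rb) fun x => rfl
  letI := Ideal.Quotient.field I
  haveI : Module.Flat κ (κ ⊗[R] M) := inferInstance
  have hii : ∀ 𝔠' : Ideal Rb, Function.Injective
      (LinearMap.lTensor N (𝔠'.subtype.restrictScalars R')) := fun 𝔠' => by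
    have h2 : Function.Injective
        ((((𝔠'.restrictScalars κ).subtype).restrictScalars R).lTensor M) :=
      lTensor_injective_of_flat_baseChange (R := R) (N := M) (S := κ) (𝔠'.restrictScalars κ)
    have h2' : Function.Injective
        (((𝔠'.subtype.restrictScalars R').restrictScalars R).lTensor M) := h2
    have h1 : Function.Injective ((𝔠'.subtype.restrictScalars R').lTensor M') :=
      injective_lTensor_of_isBaseChange hψ (𝔠'.subtype.restrictScalars R') h2'
    exact @injective_lTensor_of_flat R' M' N (↥𝔠') Rb _ _ _ _ _ _ _ _ _ _ _ _
      (𝔠'.subtype.restrictScalars R') h1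
  exact flat_of_le_jacobson (R := R') (B := N) (N := N) J hJ hi hii

/-! ### The assembly: flatness at `𝔮_{T′}` for `T′` large (Stacks 00R6) -/

section Assembly

set_option synthInstance.maxHeartbeats 400000

variable (lam : Idx f)

/-- `M ⊗ 𝔪 → M` is `M_T`-semilinear. [folklore] -/
theorem smulMap_smul (c : lam.MT 𝔮)
    (x : lam.MT 𝔮 ⊗[lam.RT 𝔮] ↥(IsLocalRing.maximalIdeal (lam.RT 𝔮))) :
    smulMap (IsLocalRing.maximalIdeal (lam.RT 𝔮)) (lam.MT 𝔮) (c • x) =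
      c * smulMap (IsLocalRing.maximalIdeal (lam.RT 𝔮)) (lam.MT 𝔮) x := by
  induction x using TensorProduct.induction_on with
  | zero => rw [smul_zero, map_zero, mul_zero]
  | add x y hx hy => rw [smul_add, map_add, map_add, hx, hy, mul_add]
  | tmul mm i =>
    rw [TensorProduct.smul_tmul', smulMap_tmul, smulMap_tmul, smul_eq_mul]
    exact (mul_smul_comm (i : lam.RT 𝔮) c mm).symm

/-- **The relation module `K = Ker(M_T ⊗ 𝔪 → M_T)`** as an `M_T`-submodule (a finite module over
the Noetherian ring `M_T`; The Stacks Project, Tag 00R6: "a finitely generated `S_λ`-module").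
[cite: StacksProject, Tag 00R6 (proof)] -/
def KM : Submodule (lam.MT 𝔮) (lam.MT 𝔮 ⊗[lam.RT 𝔮] ↥(IsLocalRing.maximalIdeal (lam.RT 𝔮))) where
  carrier := {x | smulMap (IsLocalRing.maximalIdeal (lam.RT 𝔮)) (lam.MT 𝔮) x = 0}
  add_mem' {x y} hx hy := by
    change smulMap _ _ (x + y) = 0
    rw [map_add, hx, hy, add_zero]
  zero_mem' := map_zero _
  smul_mem' c x hx := by
    change smulMap _ _ (c • x) = 0
    rw [smulMap_smul, hx, mul_zero]

/-- Membership in `K`. [folklore] -/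
theorem mem_KM {x} : x ∈ KM 𝔮 lam ↔
    smulMap (IsLocalRing.maximalIdeal (lam.RT 𝔮)) (lam.MT 𝔮) x = 0 := Iff.rfl

/-- Every `mv ∈ M_T` is `q̄/t` with `q ∈ T[x]`, `t ∈ T ∖ 𝔭_T`. [folklore] -/
theorem exists_rep (x : lam.MT 𝔮) : ∃ (q : MvPolynomial (Fin n) lam.T) (tt : lam.T)
    (htt : tt ∉ lam.pT 𝔮), x = IsLocalization.mk' (lam.MT 𝔮) (lam.mkP q)
      (⟨algebraMap lam.T lam.P tt, tt, htt, rfl⟩ : lam.ST 𝔮) := by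
  obtain ⟨z, s, rfl⟩ := IsLocalization.exists_mk'_eq (lam.ST 𝔮) x
  obtain ⟨q, rfl⟩ := lam.mkP_surjective z
  obtain ⟨tt, htt, hs⟩ := Submonoid.mem_map.mp s.2
  refine ⟨q, tt, htt, ?_⟩
  congr 1
  apply Subtype.ext
  exact hs.symm

variable {lam} in
set_option maxHeartbeats 1000000 in
set_option synthInstance.maxHeartbeats 100000 in
/-- `θ′` is `M_T`-semilinear along `ψ`. [folklore] -/
theorem baseChangeTor'_smul {mu : Idx f} [Algebra lam.T mu.T] [IsScalarTower lam.T mu.T A]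
    [Algebra (lam.RT 𝔮) (mu.RT 𝔮)] [IsScalarTower lam.T (lam.RT 𝔮) (mu.RT 𝔮)]
    [Algebra (lam.RT 𝔮) (mu.MT 𝔮)] [IsScalarTower (lam.RT 𝔮) (mu.RT 𝔮) (mu.MT 𝔮)]
    (c : lam.MT 𝔮) (x : lam.MT 𝔮 ⊗[lam.RT 𝔮] ↥(IsLocalRing.maximalIdeal (lam.RT 𝔮))) :
    baseChangeTor' (IsLocalRing.maximalIdeal (lam.RT 𝔮)) (psi 𝔮 (lam := lam) (mu := mu))
        (isBaseChange_psi 𝔮) (c • x) =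
      mapMT 𝔮 (lam := lam) (mu := mu) c •
        baseChangeTor' (IsLocalRing.maximalIdeal (lam.RT 𝔮)) (psi 𝔮 (lam := lam) (mu := mu))
          (isBaseChange_psi 𝔮) x := by
  induction x using TensorProduct.induction_on with
  | zero => rw [smul_zero, map_zero, smul_zero]
  | add x y hx hy => rw [smul_add, map_add, map_add, hx, hy, smul_add]
  | tmul mm i =>
    rw [TensorProduct.smul_tmul', baseChangeTor'_tmul, baseChangeTor'_tmul, psi_apply, psi_apply,
      smul_eq_mul, map_mul, TensorProduct.smul_tmul', smul_eq_mul]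


variable {lam} in
/-- `T ∖ 𝔭_{T′}` misses `𝔮_{T′}`: `M_{T′} → (P_{T′})_{𝔮_{T′}}` exists. [folklore] -/
theorem ST_le_primeCompl_qT (mu : Idx f) : mu.ST 𝔮 ≤ (mu.qT 𝔮).primeCompl := by
  rintro _ ⟨t, ht, rfl⟩ h
  apply ht
  rw [← comap_qT]
  exact h

section AtLevel

variable {lam} {mu : Idx f} [Algebra lam.T mu.T] [IsScalarTower lam.T mu.T A]
variable [Algebra (lam.RT 𝔮) (mu.RT 𝔮)] [IsScalarTower lam.T (lam.RT 𝔮) (mu.RT 𝔮)]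
set_option maxHeartbeats 800000 in
/-- **From `Tor₁^{R_{T′}}(R_{T′}/𝔪R_{T′}, M_{T′}) = 0` to flatness of `(P_{T′})_{𝔮_{T′}}` over
`T′`** (the local criterion `flat_of_le_jacobson` applied to the localization
`N = (P_{T′})_{𝔮_{T′}}` of `M_{T′}` with `J = 𝔪_{R_T}R_{T′} ⊆ 𝔪_{R_{T′}} ↦ 𝔪_N`; The Stacks
Project, Tags 00ML/00MO). [cite: StacksProject, Tag 00MO] -/
theorem flat_atPrime_of_injective
    [Algebra (lam.RT 𝔮) (mu.MT 𝔮)] [IsScalarTower (lam.RT 𝔮) (mu.RT 𝔮) (mu.MT 𝔮)]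
    (hinj : Function.Injective (LinearMap.lTensor (mu.MT 𝔮)
        ((IsLocalRing.maximalIdeal (lam.RT 𝔮)).map (algebraMap (lam.RT 𝔮) (mu.RT 𝔮))).subtype)) :
    Module.Flat mu.T (Localization.AtPrime (mu.qT 𝔮)) := by
  let I := IsLocalRing.maximalIdeal (lam.RT 𝔮)
  let J : Ideal (mu.RT 𝔮) := I.map (algebraMap (lam.RT 𝔮) (mu.RT 𝔮))
  let Nn := Localization.AtPrime (mu.qT 𝔮)
  letI : Algebra (mu.MT 𝔮) Nn := IsLocalization.localizationAlgebraOfSubmonoidLe (mu.MT 𝔮) Nn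
    (mu.ST 𝔮) (mu.qT 𝔮).primeCompl (ST_le_primeCompl_qT 𝔮 mu)
  haveI : IsScalarTower mu.P (mu.MT 𝔮) Nn :=
    IsLocalization.localization_isScalarTower_of_submonoid_le (mu.MT 𝔮) Nn (mu.ST 𝔮)
      (mu.qT 𝔮).primeCompl (ST_le_primeCompl_qT 𝔮 mu)
  haveI : IsLocalization (((mu.qT 𝔮).primeCompl).map (algebraMap mu.P (mu.MT 𝔮))) Nn :=
    IsLocalization.isLocalization_of_submonoid_le (mu.MT 𝔮) Nn (mu.ST 𝔮) (mu.qT 𝔮).primeCompl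
      (ST_le_primeCompl_qT 𝔮 mu)
  haveI : Module.Flat (mu.MT 𝔮) Nn :=
    IsLocalization.flat Nn (((mu.qT 𝔮).primeCompl).map (algebraMap mu.P (mu.MT 𝔮)))
  letI : Algebra (mu.RT 𝔮) Nn :=
    ((algebraMap (mu.MT 𝔮) Nn).comp (algebraMap (mu.RT 𝔮) (mu.MT 𝔮))).toAlgebra
  haveI : IsScalarTower (mu.RT 𝔮) (mu.MT 𝔮) Nn := IsScalarTower.of_algebraMap_eq fun _ => rfl
  haveI : IsScalarTower mu.T (mu.RT 𝔮) Nn := IsScalarTower.of_algebraMap_eq fun x => by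
    change algebraMap mu.T Nn x = algebraMap (mu.MT 𝔮) Nn (algebraMap (mu.RT 𝔮) (mu.MT 𝔮)
      (algebraMap mu.T (mu.RT 𝔮) x))
    rw [← IsScalarTower.algebraMap_apply mu.T (mu.RT 𝔮) (mu.MT 𝔮),
      IsScalarTower.algebraMap_apply mu.T mu.P (mu.MT 𝔮),
      ← IsScalarTower.algebraMap_apply mu.P (mu.MT 𝔮) Nn,
      IsScalarTower.algebraMap_apply mu.T mu.P Nn]
  -- the Jacobson condition
  have hJ : J.map (algebraMap (mu.RT 𝔮) Nn) ≤ (⊥ : Ideal Nn).jacobson := by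
    refine le_trans ?_ (IsLocalRing.maximalIdeal_le_jacobson ⊥)
    rw [Ideal.map_le_iff_le_comap, Ideal.map_le_iff_le_comap]
    change IsLocalRing.maximalIdeal (lam.RT 𝔮) ≤ _
    rw [← Localization.AtPrime.map_eq_maximalIdeal (I := lam.pT 𝔮), Ideal.map_le_iff_le_comap]
    intro x hx
    simp only [Ideal.mem_comap]
    rw [← Localization.AtPrime.map_eq_maximalIdeal (I := mu.qT 𝔮)]
    have e1 : algebraMap (mu.RT 𝔮) Nn (algebraMap (lam.RT 𝔮) (mu.RT 𝔮)
        (algebraMap lam.T (lam.RT 𝔮) x)) = algebraMap mu.P Nn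
          (algebraMap mu.T mu.P (algebraMap lam.T mu.T x)) := by
      rw [algebraMap_RT_RT_algebraMap, ← IsScalarTower.algebraMap_apply mu.T (mu.RT 𝔮) Nn,
        IsScalarTower.algebraMap_apply mu.T mu.P Nn]
    rw [e1]
    apply Ideal.mem_map_of_mem
    have : algebraMap lam.T mu.T x ∈ (mu.qT 𝔮).comap (algebraMap mu.T mu.P) := by
      rw [comap_qT]
      have hx' := hx
      rw [← comap_pT 𝔮 (lam := lam) (mu := mu)] at hx'
      exact hx'
    exact this
  haveI : IsNoetherianRing Nn :=
    IsLocalization.isNoetherianRing (mu.qT 𝔮).primeCompl Nn inferInstance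
  haveI : Module.Flat (mu.RT 𝔮) Nn :=
    flat_of_isBaseChange_of_injective (isBaseChange_psi 𝔮 (lam := lam) (mu := mu)) hinj hJ
  haveI : Module.Flat mu.T (mu.RT 𝔮) := IsLocalization.flat (mu.RT 𝔮) (mu.pT 𝔮).primeCompl
  exact Module.Flat.trans mu.T (mu.RT 𝔮) Nn

end AtLevel

set_option maxHeartbeats 2000000 in
/-- **Flatness spreads out to a finite level, at a prime** (The Stacks Project, Tag 00R6: for a
system `R_λ → S_λ` of local Noetherian rings with flat colimit, some `M_λ` is flat over `R_λ`),
in the form needed for Tag 02JO: if `A[x]/(f)` is flat over `A` and `𝔮` is a prime of `A[x]/(f)`,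
then for every `T` of the absolute Noetherian approximation there is a finite set `W ⊆ A` such
that for every `T′ ⊇ T ∪ W` the local ring `(P_{T′})_{𝔮 ∩ P_{T′}}` is flat over `T′`. Proof:
the relation module `K = Ker(M_T ⊗ 𝔪 → M_T)` is finitely generated; each generator is a relation
`Σ πₖ mₖ = 0` whose normal form at level `∞` (`exists_normalForm`, equational criterion for the
flat `A_𝔭`-module `(A[x]/(f))_𝔭`) has finitely many coefficients; for `T′` containing them, `θ′`
kills `K` (`theta_eq_zero_of_normalForm`), so `Tor₁^{R_{T′}}(R_{T′}/𝔪_{R_T}R_{T′}, M_{T′}) = 0`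
(`lTensor_injective_of_isBaseChange_of_isMaximal`), which passes to the localization
`N = (P_{T′})_{𝔮_{T′}}`; `N/𝔪_{R_T}N` is flat over `R_{T′}/𝔪_{R_T}R_{T′}` (a base change of the
vector space `M_T/𝔪M_T`), and the local criterion `flat_of_le_jacobson` concludes.
[cite: StacksProject, Tag 00R6] -/
theorem exists_flat_atPrime [Module.Flat A (Pinf f)] :
    ∃ W : Finset A, ∀ (mu : Idx f) [Algebra lam.T mu.T] [IsScalarTower lam.T mu.T A],
      (↑W ⊆ (mu.T : Set A)) → Module.Flat mu.T (Localization.AtPrime (mu.qT 𝔮)) := by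
  classical
  obtain ⟨t, a, ha⟩ := exists_generators_pT 𝔮 lam
  let I := IsLocalRing.maximalIdeal (lam.RT 𝔮)
  -- generators of the relation module
  haveI : Module.Finite (lam.RT 𝔮) ↥I := inferInstance
  haveI : Module.Finite (lam.MT 𝔮) (lam.MT 𝔮 ⊗[lam.RT 𝔮] ↥I) :=
    finite_tensorProduct_of_finite (R := lam.RT 𝔮) (N := lam.MT 𝔮) (B := lam.MT 𝔮) ↥I
  obtain ⟨N, g, hg⟩ := Submodule.fg_iff_exists_fin_generating_family.mp
    (IsNoetherian.noetherian (KM 𝔮 lam))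
  have hdec := fun i => exists_eq_sum_tmul 𝔮 lam a ha (g i)
  choose mv hmv using hdec
  have hrep := fun i k => exists_rep 𝔮 lam (mv i k)
  choose q tt htt hqt using hrep
  have hgK : ∀ i, g i ∈ KM 𝔮 lam := fun i => hg ▸ Submodule.subset_span ⟨i, rfl⟩
  have hrel : ∀ i, ∑ k, algebraMap lam.T (lam.RT 𝔮) (a k) •
      IsLocalization.mk' (lam.MT 𝔮) (lam.mkP (q i k))
        (⟨algebraMap lam.T lam.P (tt i k), tt i k, htt i k, rfl⟩ : lam.ST 𝔮) = 0 := by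
    intro i
    have h := (mem_KM 𝔮 lam).mp (hgK i)
    rw [hmv i, smulMap_sum_tmul 𝔮 lam a ha] at h
    rw [← h]
    exact Finset.sum_congr rfl fun k _ => by rw [hqt i k]
  have hNF := fun i => exists_normalForm 𝔮 lam a (q i) (tt i) (htt i) (hrel i)
  choose u w hu hw kk b Z c hc G d hd hI hII using hNF
  -- the finite set of coefficients
  let Su : Fin N → Finset A := fun i => {u i, w i}
  let Sc : Fin N → Finset A := fun i => Finset.univ.image (c i)
  let Sd : Fin N → Finset A := fun i => Finset.univ.image (d i)
  let Sb : Fin N → Finset A := fun i => Finset.univ.biUnion fun k => Finset.univ.image (b i k)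
  let SZ : Fin N → Finset A := fun i => Finset.univ.biUnion fun j => (Z i j).coeffs
  let SG : Fin N → Finset A := fun i =>
    Finset.univ.biUnion fun k => Finset.univ.biUnion fun i' => (G i k i').coeffs
  let S : Fin N → Finset A := fun i => Su i ∪ Sc i ∪ Sd i ∪ Sb i ∪ SZ i ∪ SG i
  refine ⟨Finset.univ.biUnion S, fun mu _ _ hW => ?_⟩
  have hS : ∀ i, ↑(S i) ⊆ (mu.T : Set A) := fun i => subset_trans
    (Finset.coe_subset.mpr (Finset.subset_biUnion_of_mem S (Finset.mem_univ i))) hW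
  have huT : ∀ i, u i ∈ mu.T := fun i => hS i (by simp [S, Su])
  have hwT : ∀ i, w i ∈ mu.T := fun i => hS i (by simp [S, Su])
  have hcT : ∀ i k, c i k ∈ mu.T := fun i k => hS i
    (Finset.mem_union_left _ (Finset.mem_union_left _ (Finset.mem_union_left _
      (Finset.mem_union_left _ (Finset.mem_union_right _
        (Finset.mem_image_of_mem _ (Finset.mem_univ k)))))))
  have hdT : ∀ i j, d i j ∈ mu.T := fun i j => hS i
    (Finset.mem_union_left _ (Finset.mem_union_left _ (Finset.mem_union_left _
      (Finset.mem_union_right _ (Finset.mem_image_of_mem _ (Finset.mem_univ j))))))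
  have hbT : ∀ i k j, b i k j ∈ mu.T := fun i k j => hS i
    (Finset.mem_union_left _ (Finset.mem_union_left _ (Finset.mem_union_right _
      (Finset.mem_biUnion.mpr ⟨k, Finset.mem_univ k, Finset.mem_image_of_mem _ (Finset.mem_univ j)⟩))))
  have hZT : ∀ i j, ((Z i j).coeffs : Set A) ⊆ mu.T := fun i j x hx => hS i
    (Finset.mem_union_left _ (Finset.mem_union_right _
      (Finset.mem_biUnion.mpr ⟨j, Finset.mem_univ j, hx⟩)))
  have hGT : ∀ i k i', ((G i k i').coeffs : Set A) ⊆ mu.T := fun i k i' x hx => hS i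
    (Finset.mem_union_right _ (Finset.mem_biUnion.mpr ⟨k, Finset.mem_univ k,
      Finset.mem_biUnion.mpr ⟨i', Finset.mem_univ i', hx⟩⟩))
  -- the structures at level `T′`
  letI := algebraRT 𝔮 (lam := lam) (mu := mu)
  haveI : IsScalarTower lam.T (lam.RT 𝔮) (mu.RT 𝔮) := isScalarTower_algebraRT 𝔮
  letI : Algebra (lam.RT 𝔮) (mu.MT 𝔮) :=
    ((algebraMap (mu.RT 𝔮) (mu.MT 𝔮)).comp (algebraMap (lam.RT 𝔮) (mu.RT 𝔮))).toAlgebra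
  haveI : IsScalarTower (lam.RT 𝔮) (mu.RT 𝔮) (mu.MT 𝔮) :=
    IsScalarTower.of_algebraMap_eq fun _ => rfl
  have hpsi := isBaseChange_psi 𝔮 (lam := lam) (mu := mu)
  -- `θ′` kills the relation module
  have hθ : ∀ x, smulMap I (lam.MT 𝔮) x = 0 →
      baseChangeTor' I (psi 𝔮 (lam := lam) (mu := mu)) hpsi x = 0 := by
    intro x hx
    have hx' : x ∈ Submodule.span (lam.MT 𝔮) (Set.range g) := hg.symm ▸ hx
    refine Submodule.span_induction (p := fun x _ =>
      baseChangeTor' I (psi 𝔮 (lam := lam) (mu := mu)) hpsi x = 0) ?_ ?_ ?_ ?_ hx'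
    · rintro _ ⟨i, rfl⟩
      rw [hmv i]
      simp only [hqt]
      exact theta_eq_zero_of_normalForm 𝔮 a ha (q i) (tt i) (htt i) (u i) (w i) (hu i) (hw i)
        (b i) (Z i) (c i) (hc i) (G i) (d i) (hd i) (hI i) (hII i) (huT i) (hwT i) (hbT i)
        (hcT i) (hdT i) (hZT i) (hGT i)
    · exact map_zero _
    · intro x y _ _ hx hy
      rw [map_add, hx, hy, add_zero]
    · intro cc x _ hx
      rw [baseChangeTor'_smul, hx, smul_zero]
  have hinj := lTensor_injective_of_isBaseChange_of_isMaximal I (psi 𝔮 (lam := lam) (mu := mu))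
    hpsi hθ
  exact flat_atPrime_of_injective 𝔮 hinj

end Assembly

end Idx

end Literature.RingTheory.Flat

end
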